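import Mathlib
import Summits.MatrixMultiplication.MatrixMultiplication.Theses.SnSubsetDichotomy
import Summits.MatrixMultiplication.MatrixMultiplication.Theorems.SnSubsetDichotomyJuntaBranchJBMaxGlue

/-!
# Restatement glue for crux `JuntaBranch` (stmt-MatrixMultiplication-8304):
# `GlobalBranch ∧ JB_∃max ⇒ NoThresholdSubsetTriple`, and `NoThresholdSubsetTriple ⇒ JB_∃max`

The crux `JuntaBranch` is quantified `∀ ε > 0, ∀ c > 0, …` and is ANTITONE in `c` (a larger `c`
lowers the volume floor `(n!)^{3/2}e^{-c√n}` and raises the required gain `e^{c+1}`), while the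
route's glue `DichotomyInduction` (item 8309, `dichotomyInduction_proof`) consumes it at a single
constant `c₀ = min (c₁/2) (1/2)` that may be shrunk at will.  Hence the weakest junta hypothesis
for which the glue still runs is

  `JB_∃max := ∀ ε > 0, ∃ c > 0, ∃ n₀, ∀ n ≥ n₀`, every VOLUME-MAXIMAL TPP triple of `S_n` with
  `|S||T||U| ≥ (n!)^{3/2}e^{-c√n}` and an `ε`-super-neutral bump improves by `e^{c+1}` in the
  window `[n - √n, n)`

(the refuter's `∀ε ∃c` re-quantification of review g2 combined with the maximal-volume weakening
of triage r1-2 T5 / `noThreshold_of_globalBranch_of_jbMax`).  This file proves, def-free: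

* `improves_mono` / `large_mono` — the two monotonicity facts behind antitonicity in `c`;
* `noThreshold_of_globalBranch_of_jbExistsMax : GlobalBranch → JB_∃max → NoThresholdSubsetTriple`
  (the potential/descent argument of `dichotomyInduction_proof` with
  `c₀ := min (c₁/2) (min (1/2) c_J)`, `c_J` the constant `JB_∃max` supplies at GlobalBranch's `ε`,
  a volume maximiser swapped in at every level as in `noThreshold_of_globalBranch_of_jbMax`);
* `jbExistsMax_of_noThreshold : NoThresholdSubsetTriple → JB_∃max` (vacuity: with the decay
  constant `c₃` of `¬X`, the floor at `c := c₃/2` is never met for large `n`);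
* `globalBranch_of_noThreshold`, hence
  `noThreshold_iff_globalBranch_and_jbExistsMax : NoThresholdSubsetTriple ↔ GlobalBranch ∧ JB_∃max`;
* `jbExistsMax_of_juntaBranch : JuntaBranch → JB_∃max` (the filed crux is stronger).

Consequence for the planner (lead a1, 2026-08-16): restating item 8304 as `JB_∃max` (or as the
intermediate `JB_∃`) costs the route nothing — the glue is re-proved here against the restated
text — and the restated item is implied by the negative side `NoThresholdSubsetTriple` (8302).
-/

set_option linter.dupNamespace false

open Literature.Combinatorics.Additive
open Summit.MatrixMultiplication.MatrixMultiplication.Theses.SnSubsetDichotomy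
open scoped Classical

namespace Summit.MatrixMultiplication.MatrixMultiplication.Theorems.JuntaBranch

/-- The volume floor is monotone in the constant: `Large(c')` implies `Large(c)` for `c' ≤ c`.
[folklore] -/
theorem large_mono {n : ℕ} {c c' V : ℝ} (hcc : c' ≤ c)
    (h : (n.factorial : ℝ) ^ ((3 : ℝ) / 2) * Real.exp (-(c' * Real.sqrt (n : ℝ))) ≤ V) :
    (n.factorial : ℝ) ^ ((3 : ℝ) / 2) * Real.exp (-(c * Real.sqrt (n : ℝ))) ≤ V := by
  refine le_trans (mul_le_mul_of_nonneg_left (Real.exp_le_exp.2 ?_) (by positivity)) h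
  have := mul_le_mul_of_nonneg_right hcc (Real.sqrt_nonneg (n : ℝ))
  linarith

/-- The improvement conclusion is antitone in the constant: a gain `e^{c+1}` is a gain `e^{c'+1}`
for `c' ≤ c`. [folklore] -/
theorem improves_mono {n : ℕ} {c c' V : ℝ} (hcc : c' ≤ c) (hV : 0 ≤ V)
    (h : ∃ n' : ℕ, (n : ℝ) - Real.sqrt (n : ℝ) ≤ (n' : ℝ) ∧ n' < n ∧
      ∃ S' T' U' : Finset (Equiv.Perm (Fin n')), TripleProductProperty S' T' U' ∧
        Real.exp (c + 1) * V * ((n'.factorial : ℝ) / (n.factorial : ℝ)) ^ ((3 : ℝ) / 2) ≤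
          ((S'.card * T'.card * U'.card : ℕ) : ℝ)) :
    ∃ n' : ℕ, (n : ℝ) - Real.sqrt (n : ℝ) ≤ (n' : ℝ) ∧ n' < n ∧
      ∃ S' T' U' : Finset (Equiv.Perm (Fin n')), TripleProductProperty S' T' U' ∧
        Real.exp (c' + 1) * V * ((n'.factorial : ℝ) / (n.factorial : ℝ)) ^ ((3 : ℝ) / 2) ≤
          ((S'.card * T'.card * U'.card : ℕ) : ℝ) := by
  obtain ⟨n', h1, h2, S', T', U', hT, hle⟩ := h
  refine ⟨n', h1, h2, S', T', U', hT, le_trans ?_ hle⟩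
  have hr : 0 ≤ ((n'.factorial : ℝ) / (n.factorial : ℝ)) ^ ((3 : ℝ) / 2) := by positivity
  refine mul_le_mul_of_nonneg_right (mul_le_mul_of_nonneg_right ?_ hV) hr
  exact Real.exp_le_exp.2 (by linarith)

/-- **`GlobalBranch ∧ JB_∃max ⇒ NoThresholdSubsetTriple`.**  The second hypothesis is the crux
`JuntaBranch` with TWO weakenings: the constant `c` is existential after `ε` (`∀ ε > 0, ∃ c > 0`,
refuter review g2) and the triple is assumed volume-maximal among the TPP triples of its `S_n`
(triage r1-2 T5).  Proof: the potential/descent argument of `dichotomyInduction_proof` run at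
`c₀ := min (c₁/2) (min (1/2) c_J)` where `c_J` is the constant supplied at GlobalBranch's `ε`;
at each level a volume maximiser is swapped in (`exists_maxVol_triple`), `Large(c₀) ⇒ Large(c_J)`
(`large_mono`) feeds the hypothesis and the gain `e^{c_J+1} ≥ e^{c₀+1}` (`improves_mono`) feeds
`dichotomyInduction_potential_step`. -/
theorem noThreshold_of_globalBranch_of_jbExistsMax :
    GlobalBranch →
    (∀ ε : ℝ, 0 < ε → ∃ c : ℝ, 0 < c ∧ ∃ n₀ : ℕ, ∀ n ≥ n₀, ∀ S T U : Finset (Equiv.Perm (Fin n)),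
      TripleProductProperty S T U →
      (n.factorial : ℝ) ^ ((3 : ℝ) / 2) * Real.exp (-(c * Real.sqrt (n : ℝ))) ≤
        ((S.card * T.card * U.card : ℕ) : ℝ) →
      (∀ S₁ T₁ U₁ : Finset (Equiv.Perm (Fin n)), TripleProductProperty S₁ T₁ U₁ →
        S₁.card * T₁.card * U₁.card ≤ S.card * T.card * U.card) →
      (∃ X : Finset (Equiv.Perm (Fin n)), (X = S ∨ X = T ∨ X = U) ∧ ∃ t : ℕ, 1 ≤ t ∧
        (t : ℝ) ≤ Real.sqrt (n : ℝ) ∧ ∃ I L : Fin t → Fin n, Function.Injective I ∧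
        Function.Injective L ∧ (n : ℝ) ^ ((1 / 2 + ε) * t) * (X.card : ℝ) <
          ((X.filter (fun σ => ∀ k, σ (I k) = L k)).card : ℝ) * (n.descFactorial t : ℝ)) →
      ∃ n' : ℕ, (n : ℝ) - Real.sqrt (n : ℝ) ≤ (n' : ℝ) ∧ n' < n ∧
        ∃ S' T' U' : Finset (Equiv.Perm (Fin n')), TripleProductProperty S' T' U' ∧
          Real.exp (c + 1) * ((S.card * T.card * U.card : ℕ) : ℝ) *
              ((n'.factorial : ℝ) / (n.factorial : ℝ)) ^ ((3 : ℝ) / 2) ≤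
            ((S'.card * T'.card * U'.card : ℕ) : ℝ)) →
    NoThresholdSubsetTriple := by
  intro hGB hJB
  obtain ⟨ε, hε, c₁, hc₁, n₁, hG⟩ := hGB
  obtain ⟨cJ, hcJ, n₂, hJ⟩ := hJB ε hε
  -- the constants
  set c₀ : ℝ := min (c₁ / 2) (min (1 / 2) cJ) with hc₀def
  have hc₀pos : 0 < c₀ := lt_min (half_pos hc₁) (lt_min one_half_pos hcJ)
  have hc₀lt : c₀ < c₁ := (min_le_left _ _).trans_lt (half_lt_self hc₁)
  have hc₀half : c₀ ≤ 1 / 2 := (min_le_right _ _).trans (min_le_left _ _)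
  have hc₀J : c₀ ≤ cJ := (min_le_right _ _).trans (min_le_right _ _)
  set M : ℕ := max n₁ n₂ + 1 with hMdef
  refine ⟨c₀, hc₀pos, 2 * M, fun n hn S T U hTPP => ?_⟩
  by_contra hlt
  rw [not_le] at hlt
  have h2M : (2 * M : ℝ) ≤ n := by exact_mod_cast hn
  have hsqn : Real.sqrt n * Real.sqrt n = n := Real.mul_self_sqrt (Nat.cast_nonneg n)
  -- the descent: `R k` for all `k ≤ c₀√n + 1`
  have hR : ∀ k : ℕ, (k : ℝ) ≤ c₀ * Real.sqrt n + 1 → ∃ m : ℕ, m ≤ n ∧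
      (n : ℝ) - k * Real.sqrt n ≤ m ∧ ∃ S T U : Finset (Equiv.Perm (Fin m)),
      TripleProductProperty S T U ∧
      Real.exp k * ((m.factorial : ℝ) ^ ((3 : ℝ) / 2) * Real.exp (-(c₀ * Real.sqrt m))) ≤
        ((S.card * T.card * U.card : ℕ) : ℝ) := by
    intro k
    induction k with
    | zero =>
      intro _
      refine ⟨n, le_rfl, by simp, S, T, U, hTPP, ?_⟩
      simpa using hlt.le
    | succ k ih =>
      intro hk
      simp only [Nat.cast_add_one] at hk ⊢
      have hk' : (k : ℝ) ≤ c₀ * Real.sqrt n := by linarith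
      obtain ⟨m, hmn, hkm, S₀, T₀, U₀, hTPP₀, hP₀⟩ := ih (by linarith)
      -- swap in a volume maximiser at level `m` (it only raises the potential)
      obtain ⟨Sm, Tm, Um, hTPPm, hmaxm⟩ := exists_maxVol_triple m
      have hvol : ((S₀.card * T₀.card * U₀.card : ℕ) : ℝ) ≤
          ((Sm.card * Tm.card * Um.card : ℕ) : ℝ) := by
        exact_mod_cast hmaxm S₀ T₀ U₀ hTPP₀
      have hPm : Real.exp k * ((m.factorial : ℝ) ^ ((3 : ℝ) / 2) *
          Real.exp (-(c₀ * Real.sqrt m))) ≤ ((Sm.card * Tm.card * Um.card : ℕ) : ℝ) :=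
        hP₀.trans hvol
      -- the level stays above `M`
      have hkn : (k : ℝ) * Real.sqrt n ≤ c₀ * n := by
        calc (k : ℝ) * Real.sqrt n ≤ c₀ * Real.sqrt n * Real.sqrt n :=
            mul_le_mul_of_nonneg_right hk' (Real.sqrt_nonneg _)
          _ = c₀ * n := by rw [mul_assoc, hsqn]
      have hc₀n : c₀ * n ≤ 1 / 2 * n := mul_le_mul_of_nonneg_right hc₀half (Nat.cast_nonneg n)
      have hMm : M ≤ m := by
        have h : (M : ℝ) ≤ m := by linarith
        exact_mod_cast h
      have hmax : max n₁ n₂ ≤ m := Nat.le_of_succ_le hMm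
      have hm₁ : n₁ ≤ m := le_of_max_le_left hmax
      have hm₂ : n₂ ≤ m := le_of_max_le_right hmax
      have hm1 : 1 ≤ m := le_trans (Nat.le_add_left 1 _) hMm
      have hfm : (0 : ℝ) < m.factorial := by exact_mod_cast m.factorial_pos
      have hsm : 0 < Real.sqrt m := Real.sqrt_pos.2 (by exact_mod_cast hm1)
      -- threshold at level `m`, at `c₀` and (weaker) at `cJ`
      have hthr : (m.factorial : ℝ) ^ ((3 : ℝ) / 2) * Real.exp (-(c₀ * Real.sqrt m)) ≤
          ((Sm.card * Tm.card * Um.card : ℕ) : ℝ) :=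
        le_trans (le_mul_of_one_le_left (by positivity) (Real.one_le_exp (Nat.cast_nonneg k))) hPm
      have hthrJ : (m.factorial : ℝ) ^ ((3 : ℝ) / 2) * Real.exp (-(cJ * Real.sqrt m)) ≤
          ((Sm.card * Tm.card * Um.card : ℕ) : ℝ) := large_mono hc₀J hthr
      rcases dichotomyInduction_and_or_not (hG m hm₁ Sm Tm Um hTPPm) with ⟨-, hbound⟩ | hnb
      · -- bump-free: contradicts `GlobalBranch`
        exact (dichotomyInduction_nobump_absurd hfm (Nat.cast_nonneg k) hc₀lt hsm hPm hbound).elim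
      · -- a super-neutral bump in a MAXIMISER: JB_∃max descends with gain e^{cJ+1} ≥ e^{c₀+1}
        push Not at hnb
        obtain ⟨m', hm'ge, hm'lt, S', T', U', hTPP', hP'⟩ :=
          improves_mono hc₀J (Nat.cast_nonneg _) (hJ m hm₂ Sm Tm Um hTPPm hthrJ hmaxm hnb)
        refine ⟨m', hm'lt.le.trans hmn, ?_, S', T', U', hTPP', ?_⟩
        · have hsmn : Real.sqrt m ≤ Real.sqrt n := Real.sqrt_le_sqrt (by exact_mod_cast hmn)
          linarith
        · exact dichotomyInduction_potential_step hc₀pos hfm (Nat.cast_nonneg _)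
            (by linarith [dichotomyInduction_sqrt_sub_one_le (Nat.cast_nonneg m) hm'ge]) hPm hP'
  -- the end of the descent: `K := ⌊c₀√n⌋ + 1` steps beat the packing bound
  have hc₀s : 0 ≤ c₀ * Real.sqrt n := mul_nonneg hc₀pos.le (Real.sqrt_nonneg _)
  obtain ⟨m, hmn, -, Sm, Tm, Um, hTPPm, hPm⟩ := hR (⌊c₀ * Real.sqrt n⌋₊ + 1)
    (by push_cast; linarith [Nat.floor_le hc₀s])
  have hfm : (0 : ℝ) < m.factorial := by exact_mod_cast m.factorial_pos
  have hsmn : Real.sqrt m ≤ Real.sqrt n := Real.sqrt_le_sqrt (by exact_mod_cast hmn)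
  exact dichotomyInduction_final_absurd hfm (K := ((⌊c₀ * Real.sqrt n⌋₊ + 1 : ℕ) : ℝ))
    (by push_cast; exact Nat.lt_floor_add_one _) (mul_le_mul_of_nonneg_left hsmn hc₀pos.le) hPm
    (dichotomyInduction_card_le_rpow hTPPm)

/-- **`NoThresholdSubsetTriple ⇒ JB_∃max`** (vacuity).  If every TPP triple of `S_n`, `n ≥ n₃`,
has `|S||T||U| ≤ (n!)^{3/2}e^{-c₃√n}`, then at `c := c₃/2` the volume floor
`(n!)^{3/2}e^{-(c₃/2)√n} ≤ |S||T||U|` fails for `n ≥ max n₃ 1` (as `e^{-c₃√n} < e^{-(c₃/2)√n}`),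
so the restated junta branch holds with nothing to check. -/
theorem jbExistsMax_of_noThreshold :
    NoThresholdSubsetTriple →
    (∀ ε : ℝ, 0 < ε → ∃ c : ℝ, 0 < c ∧ ∃ n₀ : ℕ, ∀ n ≥ n₀, ∀ S T U : Finset (Equiv.Perm (Fin n)),
      TripleProductProperty S T U →
      (n.factorial : ℝ) ^ ((3 : ℝ) / 2) * Real.exp (-(c * Real.sqrt (n : ℝ))) ≤
        ((S.card * T.card * U.card : ℕ) : ℝ) →
      (∀ S₁ T₁ U₁ : Finset (Equiv.Perm (Fin n)), TripleProductProperty S₁ T₁ U₁ →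
        S₁.card * T₁.card * U₁.card ≤ S.card * T.card * U.card) →
      (∃ X : Finset (Equiv.Perm (Fin n)), (X = S ∨ X = T ∨ X = U) ∧ ∃ t : ℕ, 1 ≤ t ∧
        (t : ℝ) ≤ Real.sqrt (n : ℝ) ∧ ∃ I L : Fin t → Fin n, Function.Injective I ∧
        Function.Injective L ∧ (n : ℝ) ^ ((1 / 2 + ε) * t) * (X.card : ℝ) <
          ((X.filter (fun σ => ∀ k, σ (I k) = L k)).card : ℝ) * (n.descFactorial t : ℝ)) →
      ∃ n' : ℕ, (n : ℝ) - Real.sqrt (n : ℝ) ≤ (n' : ℝ) ∧ n' < n ∧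
        ∃ S' T' U' : Finset (Equiv.Perm (Fin n')), TripleProductProperty S' T' U' ∧
          Real.exp (c + 1) * ((S.card * T.card * U.card : ℕ) : ℝ) *
              ((n'.factorial : ℝ) / (n.factorial : ℝ)) ^ ((3 : ℝ) / 2) ≤
            ((S'.card * T'.card * U'.card : ℕ) : ℝ)) := by
  rintro ⟨c₃, hc₃, n₃, hN⟩ ε _
  refine ⟨c₃ / 2, half_pos hc₃, max n₃ 1, fun n hn S T U hTPP hLarge _ _ => ?_⟩
  exfalso
  have hn₃ : n₃ ≤ n := le_of_max_le_left hn
  have hn1 : 1 ≤ n := le_of_max_le_right hn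
  have hup := hN n hn₃ S T U hTPP
  have hF : (0 : ℝ) < (n.factorial : ℝ) ^ ((3 : ℝ) / 2) :=
    Real.rpow_pos_of_pos (by exact_mod_cast n.factorial_pos) _
  have hs : 0 < Real.sqrt (n : ℝ) := Real.sqrt_pos.2 (by exact_mod_cast hn1)
  have hlt : Real.exp (-(c₃ * Real.sqrt (n : ℝ))) < Real.exp (-(c₃ / 2 * Real.sqrt (n : ℝ))) := by
    rw [Real.exp_lt_exp]
    nlinarith
  have := lt_of_le_of_lt (hLarge.trans hup) (mul_lt_mul_of_pos_left hlt hF)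
  exact lt_irrefl _ this

/-- `NoThresholdSubsetTriple ⇒ GlobalBranch` (the global branch is a corollary of the negative
side: its conclusion is the negative side's bound under extra hypotheses). [folklore] -/
theorem globalBranch_of_noThreshold : NoThresholdSubsetTriple → GlobalBranch := by
  rintro ⟨c₃, hc₃, n₃, hN⟩
  exact ⟨1, one_pos, c₃, hc₃, n₃, fun n hn S T U hTPP _ => hN n hn S T U hTPP⟩

/-- **The restated dichotomy is an exact reformulation of the negative side**:
`NoThresholdSubsetTriple ↔ GlobalBranch ∧ JB_∃max`. -/
theorem noThreshold_iff_globalBranch_and_jbExistsMax :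
    NoThresholdSubsetTriple ↔
    (GlobalBranch ∧
    (∀ ε : ℝ, 0 < ε → ∃ c : ℝ, 0 < c ∧ ∃ n₀ : ℕ, ∀ n ≥ n₀, ∀ S T U : Finset (Equiv.Perm (Fin n)),
      TripleProductProperty S T U →
      (n.factorial : ℝ) ^ ((3 : ℝ) / 2) * Real.exp (-(c * Real.sqrt (n : ℝ))) ≤
        ((S.card * T.card * U.card : ℕ) : ℝ) →
      (∀ S₁ T₁ U₁ : Finset (Equiv.Perm (Fin n)), TripleProductProperty S₁ T₁ U₁ →
        S₁.card * T₁.card * U₁.card ≤ S.card * T.card * U.card) →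
      (∃ X : Finset (Equiv.Perm (Fin n)), (X = S ∨ X = T ∨ X = U) ∧ ∃ t : ℕ, 1 ≤ t ∧
        (t : ℝ) ≤ Real.sqrt (n : ℝ) ∧ ∃ I L : Fin t → Fin n, Function.Injective I ∧
        Function.Injective L ∧ (n : ℝ) ^ ((1 / 2 + ε) * t) * (X.card : ℝ) <
          ((X.filter (fun σ => ∀ k, σ (I k) = L k)).card : ℝ) * (n.descFactorial t : ℝ)) →
      ∃ n' : ℕ, (n : ℝ) - Real.sqrt (n : ℝ) ≤ (n' : ℝ) ∧ n' < n ∧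
        ∃ S' T' U' : Finset (Equiv.Perm (Fin n')), TripleProductProperty S' T' U' ∧
          Real.exp (c + 1) * ((S.card * T.card * U.card : ℕ) : ℝ) *
              ((n'.factorial : ℝ) / (n.factorial : ℝ)) ^ ((3 : ℝ) / 2) ≤
            ((S'.card * T'.card * U'.card : ℕ) : ℝ))) :=
  ⟨fun h => ⟨globalBranch_of_noThreshold h, jbExistsMax_of_noThreshold h⟩,
    fun h => noThreshold_of_globalBranch_of_jbExistsMax h.1 h.2⟩

/-- **The filed crux is stronger than the restated one**: `JuntaBranch → JB_∃max` (take `c := 1`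
and forget maximality). -/
theorem jbExistsMax_of_juntaBranch :
    JuntaBranch →
    (∀ ε : ℝ, 0 < ε → ∃ c : ℝ, 0 < c ∧ ∃ n₀ : ℕ, ∀ n ≥ n₀, ∀ S T U : Finset (Equiv.Perm (Fin n)),
      TripleProductProperty S T U →
      (n.factorial : ℝ) ^ ((3 : ℝ) / 2) * Real.exp (-(c * Real.sqrt (n : ℝ))) ≤
        ((S.card * T.card * U.card : ℕ) : ℝ) →
      (∀ S₁ T₁ U₁ : Finset (Equiv.Perm (Fin n)), TripleProductProperty S₁ T₁ U₁ →
        S₁.card * T₁.card * U₁.card ≤ S.card * T.card * U.card) →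
      (∃ X : Finset (Equiv.Perm (Fin n)), (X = S ∨ X = T ∨ X = U) ∧ ∃ t : ℕ, 1 ≤ t ∧
        (t : ℝ) ≤ Real.sqrt (n : ℝ) ∧ ∃ I L : Fin t → Fin n, Function.Injective I ∧
        Function.Injective L ∧ (n : ℝ) ^ ((1 / 2 + ε) * t) * (X.card : ℝ) <
          ((X.filter (fun σ => ∀ k, σ (I k) = L k)).card : ℝ) * (n.descFactorial t : ℝ)) →
      ∃ n' : ℕ, (n : ℝ) - Real.sqrt (n : ℝ) ≤ (n' : ℝ) ∧ n' < n ∧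
        ∃ S' T' U' : Finset (Equiv.Perm (Fin n')), TripleProductProperty S' T' U' ∧
          Real.exp (c + 1) * ((S.card * T.card * U.card : ℕ) : ℝ) *
              ((n'.factorial : ℝ) / (n.factorial : ℝ)) ^ ((3 : ℝ) / 2) ≤
            ((S'.card * T'.card * U'.card : ℕ) : ℝ)) := by
  intro hJB ε hε
  obtain ⟨n₀, h⟩ := hJB ε hε 1 one_pos
  exact ⟨1, one_pos, n₀, fun n hn S T U hTPP hL _ hb => h n hn S T U hTPP hL hb⟩

end Summit.MatrixMultiplication.MatrixMultiplication.Theorems.JuntaBranch
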